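import Literature.Analysis.OperatorTheory.YangMillsMatrixModelGroundStatePositivity
import Literature.Analysis.OperatorTheory.YangMillsMatrixModelCoreDatumAbs
import Literature.Analysis.OperatorTheory.YangMillsMatrixModelDiscreteness
import Literature.Analysis.UnboundedOperators.CoreFormGroundStateSimple
import HarnessLib

/-!
# `LuscherSimonGap` holds: the invariant ground state of Lüscher's matrix-model Hamiltonian is simple

Topic `Literature/Analysis/OperatorTheory`; DISCHARGE of the named fact
`Literature.Analysis.OperatorTheory.YMMatrixModel.LuscherSimonGap`
(`YangMillsMatrixModelDiscreteSpectrum.lean`: `Tendsto physLevel atTop atTop ∧ 0 < luscherEps1`) for the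
`SO(3)`-invariant min–max levels `physLevel` of `𝔥 = −½Δ + ¼Σ|x_i × x_j|²` on `ℝ⁹`.  Discreteness
(`tendsto_physLevel_atTop`, Simon 1983) is already a tree theorem (`YangMillsMatrixModelDiscreteness.lean`,
which reduces the fact to `0 < luscherEps1 = physLevel 2 − physLevel 1`).  The strict gap
`physLevel 1 < physLevel 2` — SIMPLICITY OF THE GROUND STATE in min–max language — is the abstract
Perron–Frobenius criterion of Lieb–Loss Thm. 11.8 / Reed–Simon XIII.48 in variational form
(`Literature.Analysis.UnboundedOperators.sInf_coreLevelSet_zero_lt_one`, `CoreFormGroundStateSimple.lean`)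
instantiated on the datum of Lüscher's form (`YangMillsMatrixModelCoreDatum.lean`: the invariant `C²_c` core
`V`, `ι`, `S = 𝔥`, Kato's identity, Rellich compactness, `sInf` of the Rayleigh sets `= physLevel (k+1)`), with

* `habs` = `coreSpace_habs` — `|·|`-stability of the core (Beurling–Deny regularisation `√(ψ²+δ²) − δ`,
  `YangMillsMatrixModelCoreAbsStability.lean` / `…CoreDatumAbs.lean`, seat ym-luscher-20007-p2);
* `hpos` = `coreSpace_positivityImproving` — positivity improving: a non-negative non-zero weak invariant
  eigenvector pairs strictly positively with every non-negative non-zero `L²` vector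
  (`inner_pos_of_weak_invariant_nonneg`: `SO(3)`-averaging + elliptic regularity + E. Hopf's minimum principle,
  `YangMillsMatrixModelGroundStatePositivity.lean`).

Main results: ★ `physLevel_one_lt_physLevel_two`, `luscherEps1_pos`, ★ `LuscherSimonGap_holds`.
Theorems only; no definitions, no new named facts (net debt −1).

## References
* [SimonB1983DiscreteSpectrum] B. Simon, *Some quantum operators with discrete spectrum but classically
  continuous spectrum*, Ann. Phys. 146 (1983), Thm. 3, p. 211 (discreteness).
* [ReedSimonIV1978] M. Reed, B. Simon, *Methods of Modern Mathematical Physics IV*, §XIII.12, Thm. XIII.47–48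
  (positivity improving ⇒ non-degenerate strictly positive ground state), Thm. XIII.2 (min–max).
* [LiebLoss2001] E. H. Lieb, M. Loss, *Analysis*, 2nd ed., Thm. 11.8 (uniqueness of minimizers, PDF
  pp. 205–206), Thm. 7.8 (convexity inequality for gradients).
* [LuscherMunster1984] M. Lüscher, G. Münster, *Weak-coupling expansion of the low-lying energy values in
  the SU(2) gauge theory on a torus*, Nucl. Phys. B 232 (1984) §2 (the gap `ε₁ > 0` of the effective
  Hamiltonian).
-/

noncomputable section

open MeasureTheory Filter
open scoped RealInnerProductSpace

namespace Literature.Analysis.OperatorTheory.YMMatrixModel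

/-- **Positivity improving on Lüscher's form core** (hypothesis `hpos` of `sInf_coreLevelSet_zero_lt_one` for
the datum): a weak eigenvector `w ≥ 0`, `w ≠ 0`, in the closure of `range ι` pairs strictly positively with
every `v ≥ 0`, `v ≠ 0` — `inner_pos_of_weak_invariant_nonneg` read through `range_coreEmbedding_eq` and
`weak_eq_of_coreSpace`. [cite: ReedSimonIV1978, Thm. XIII.48] -/
theorem coreSpace_positivityImproving (c : ℝ) (w : Lp ℝ 2 (volume : Measure ZM))
    (hw : w ∈ closure (Set.range coreEmbedding))
    (hweak : ∀ g : coreSpace, ⟪w, coreOp g⟫ = c * ⟪w, coreEmbedding g⟫) (hw0 : 0 ≤ w) (hwne : w ≠ 0)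
    (v : Lp ℝ 2 (volume : Measure ZM)) (hv0 : 0 ≤ v) (hvne : v ≠ 0) : 0 < ⟪w, v⟫ := by
  rw [range_coreEmbedding_eq] at hw
  exact inner_pos_of_weak_invariant_nonneg hw
    (fun g hg hgg => weak_eq_of_coreSpace w c hg hgg (hweak _)) hw0 hwne v hv0 hvne

/-- Reading lemma: the infimum of the FIRST Rayleigh set of the datum is `physLevel 1`
(`sInf_coreSpace_rayleigh 0` with `0 + 1` evaluated). [cite: ReedSimonIV1978, Thm. XIII.2] -/
theorem sInf_coreSpace_rayleigh_one :
    sInf {s : ℝ | ∃ W : Submodule ℝ coreSpace, Module.finrank ℝ W = 1 ∧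
      ∀ f ∈ W, ‖f‖ ^ 2 - ‖coreEmbedding f‖ ^ 2 ≤ s * ‖coreEmbedding f‖ ^ 2} = physLevel 1 := by
  have h := sInf_coreSpace_rayleigh 0
  simp only [zero_add] at h
  exact h

/-- Reading lemma: the infimum of the SECOND Rayleigh set of the datum is `physLevel 2`
(`sInf_coreSpace_rayleigh 1` with `1 + 1` evaluated). [cite: ReedSimonIV1978, Thm. XIII.2] -/
theorem sInf_coreSpace_rayleigh_two :
    sInf {s : ℝ | ∃ W : Submodule ℝ coreSpace, Module.finrank ℝ W = 2 ∧
      ∀ f ∈ W, ‖f‖ ^ 2 - ‖coreEmbedding f‖ ^ 2 ≤ s * ‖coreEmbedding f‖ ^ 2} = physLevel 2 := by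
  have h := sInf_coreSpace_rayleigh 1
  simp only [one_add_one_eq_two] at h
  exact h

set_option maxHeartbeats 400000 in
/-- ★ **The invariant ground state of `𝔥` is simple: `physLevel 1 < physLevel 2`** (the first two
`SO(3)`-invariant min–max levels are distinct).  Lieb–Loss 11.8 / Reed–Simon XIII.48 in the variational form
`sInf_coreLevelSet_zero_lt_one`, on the datum of `YangMillsMatrixModelCoreDatum.lean`.
[cite: ReedSimonIV1978, Thm. XIII.47–48] [cite: LiebLoss2001, Thm. 11.8, PDF pp. 205–206] -/
theorem physLevel_one_lt_physLevel_two : physLevel 1 < physLevel 2 := by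
  have h : sInf {s : ℝ | ∃ W : Submodule ℝ coreSpace, Module.finrank ℝ W = 1 ∧
        ∀ f ∈ W, ‖f‖ ^ 2 - ‖coreEmbedding f‖ ^ 2 ≤ s * ‖coreEmbedding f‖ ^ 2} <
      sInf {s : ℝ | ∃ W : Submodule ℝ coreSpace, Module.finrank ℝ W = 2 ∧
        ∀ f ∈ W, ‖f‖ ^ 2 - ‖coreEmbedding f‖ ^ 2 ≤ s * ‖coreEmbedding f‖ ^ 2} :=
    Literature.Analysis.UnboundedOperators.sInf_coreLevelSet_zero_lt_one
      not_finiteDimensional_coreSpace coreEmbedding coreOp coreSpace_form_identity coreSpace_totallyBounded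
      coreSpace_habs coreSpace_positivityImproving
  rw [sInf_coreSpace_rayleigh_one, sInf_coreSpace_rayleigh_two] at h
  exact h

/-- **Lüscher's gap is positive**: `0 < ε₁ = physLevel 2 − physLevel 1`. [cite: LuscherMunster1984, §2] [cite: ReedSimonIV1978, Thm. XIII.47–48] -/
theorem luscherEps1_pos : 0 < luscherEps1 :=
  sub_pos.2 physLevel_one_lt_physLevel_two

/-- ★ **DISCHARGE of the named fact `LuscherSimonGap`**: the invariant levels of Lüscher's effective
Hamiltonian are discrete (`physLevel → ∞`, Simon 1983) and the ground state is simple (`0 < ε₁`).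
[cite: SimonB1983DiscreteSpectrum, Thm. 3 p. 211] [cite: ReedSimonIV1978, Thm. XIII.47–48] [cite: LuscherMunster1984, §2] -/
theorem LuscherSimonGap_holds : LuscherSimonGap :=
  luscherSimonGap_iff_eps1_pos.2 luscherEps1_pos

end Literature.Analysis.OperatorTheory.YMMatrixModel

end
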